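import Summits.BirchSwinnertonDyer.BirchSwinnertonDyer.Theorems.PrintCf2RamifiedOffTYZLevelTwoTwoPrimesEven
import Summits.BirchSwinnertonDyer.Rank1Residual.P2.CongruentNumberThetaCriterionCosets
import HarnessLib

/-!
# Crux `PrintCf2.RamifiedOffTYZOfFacts` (stmt-BirchSwinnertonDyer-20509), line `offtyz-v7`, LEAD cycle 11 (cruxlead-20509 g10), part 3:
# THE TWO-STEP EXPANSION OF THE RECURSION (all `n`) AND THE FIRST THREE-PRIME SECTOR `n = l₁l₂m` OF C⁺

THEOREMS ONLY (no `def`, no named fact, no `sorry`), `--supports stmt-BirchSwinnertonDyer-20509` (stub 7 = C⁺ = item 23431).  Sequel of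
`…LevelTwoTwoPrimes` (p720648, odd k = 2) and `…LevelTwoTwoPrimesEven` (p721307, even k = 2); same HONEST FRAMING (bookkeeping on TYZ §3 AS
DISPLAYED; display-shaped hypotheses = Thm 3.5's main clause for proper divisors read inside `ℍ′_n`; GZK by name inside g3's criterion).
Nothing is asserted; C⁺ stays open; BSD is not proved by any of this.

* §1 **`P_eq_two_step`** (every `n`, every divisor `d ≡ 5, 6, 7 (mod 8)`): unfolding the displayed recursion twice,
  `P(d) = Z(d) − Σ_{d₀ ∈ R(d)} κ_{d,d₀} Z(d₀) + Σ_{d₀ ∈ R(d)} Σ_{e ∈ R(d₀)} κ_{d,d₀} κ_{d₀,e} P(e)`, `κ_{a,b} = i^{ε(b, a/b)}·𝓛(a/b)·(−)`, EXACT in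
  `A(ℍ′_n)`; `P(e) = Z(e)` at the leaves `R(e) = ∅` (`P_eq_Z_of_recursionIndex_eq_empty`).  For square-free `n` with at most three odd prime
  factors every chain of the recursion has length `≤ 2`, so this is the whole genus-point expansion there (the integral refinement of Prop. 3.4,
  which is its reduction mod `2A(ℍ′_n)`).
* §2 THE FIRST THREE-PRIME SECTOR.  Monsky's matrix (LEAD instrument `instruments/k3_types.py`, exhaustive): `n = l₁l₂m` with `l₁ ≡ l₂ ≡ 1`,
  `m ≡ 5` or `7 (mod 8)` has `s(n) = 3` iff EXACTLY ONE of `(l₂/l₁), (m/l₁), (m/l₂)` is `−1` (and `s(n) = 5` iff all three are `+1`).  For this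
  residue type (any symbols) `R(n) = {m, l₁m, l₂m}` (`recursionIndex_typeT`), `R(lᵢm) = {m}`, `R(m) = ∅`, so
  `P(n) = Z(n) − s₀𝓛(l₁l₂)·Z(m) − s₁𝓛(l₂)·P(l₁m) − s₂𝓛(l₁)·P(l₂m)` EXACT (`P_eq_of_typeT`), and with `𝓛(lᵢ) = 2cᵢ` and Thm 3.5 at the two
  two-prime sub-twists `l₁m`, `l₂m`:
  **`P(l₁l₂m) ≡ Z(l₁l₂m) − s₀𝓛(l₁l₂)·Z(m) − (s₁c₂u₁𝓛(l₁m))·α₁ − (s₂c₁u₂𝓛(l₂m))·α₂` (mod torsion)** (`genusPoint_typeT_congr`) — the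
  three-prime genus point SEES the prime's genus point `Z(m) = P(m)` with the coefficient `𝓛(l₁l₂)` (parity `g(l₁l₂) mod 2`, Thm 1.1 at the
  rank-zero twist `l₁l₂ ≡ 1 (mod 8)`; NOT always even), and the half-generators of the two-prime sub-twists `E_{lᵢm}` (each of type R1/R2 when
  `(m/lᵢ) = +1`, i.e. themselves in the `s = 3` class, else `s = 1` with `𝓛(lᵢm)` odd); `…_of_even` folds `Z(m)` into `α_m` when `𝓛(l₁l₂) = 2b`.
  C⁺ at `l₁l₂m` = ONE depth comparison (`levelTwo_typeT_iff_of_even`, the case `𝓛(l₁l₂)` even; the odd case keeps `Z(m)` verbatim).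

References: [cite: TianYuanZhang2017, §3.1 (p0011 L53–L73), Thm. 3.3 (p0011 L49–L51), Prop. 3.4 (p0011 L76–L89), Thm. 3.5 (p0011 L94–L100),
Thm. 1.1]; [cite: Darmon2004, Thm. 3.22]; [cite: HeathBrown1994SelmerCongruentII, Appendix (Monsky), typescript p. 39 L27–L33]; tree: p720648,
p721307, g3 `…LevelTwoDepth`, bsd-monsky `Rank1Residual/P2/DecompositionsThreePrimes` (`dvd_mul_three_iff`), `…ThetaCriterionCosets`
(`ThetaDescent.mem_recursionIndex_iff`).
-/

noncomputable section

open scoped Classical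

open WeierstrassCurve WeierstrassCurve.Affine Literature.NumberTheory.EllipticCurves
  Literature.NumberTheory.EllipticCurves.TianYuanZhang2017
  Literature.NumberTheory.EllipticCurves.TianYuanZhang2017.W2
  Summit.BirchSwinnertonDyer.Rank1Residual.P2
  Summit.BirchSwinnertonDyer.PrintCf2.LevelTwoHalfGenerator
  Summit.BirchSwinnertonDyer.PrintCf2.LevelTwoDepth
  Summit.BirchSwinnertonDyer.PrintCf2.LevelTwoTwoPrimes
  Summit.BirchSwinnertonDyer.PrintCf2.LevelTwoTwoPrimesEven

set_option autoImplicit false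

namespace Summit.BirchSwinnertonDyer.PrintCf2.LevelTwoTwoStep

variable {n : ℕ}

/-! ## §1 The two-step expansion of the displayed recursion (every `n`) -/

/-- A leaf of the recursion: `R(e) = ∅ ⟹ P(e) = Z(e)`. [cite: TianYuanZhang2017, §3.1 (p0011 L67–L73)] -/
theorem P_eq_Z_of_recursionIndex_eq_empty (D : GenusPointData n) (hrec : D.recursion) {e : ℕ} (he : e ∈ n.divisors)
    (he8 : e % 8 = 5 ∨ e % 8 = 6 ∨ e % 8 = 7) (hR : recursionIndex e = ∅) : D.P e = D.Z e := by
  have h := hrec e he he8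
  rw [hR, Finset.sum_empty, sub_zero] at h
  exact h

/-- **THE TWO-STEP EXPANSION** (every `n`, every divisor `d ≡ 5, 6, 7 (mod 8)` of `n`): unfolding the displayed recursion at `d` and at each
`d₀ ∈ R(d)`, `P(d) = Z(d) − Σ_{d₀ ∈ R(d)} i^{ε}𝓛(d/d₀)·Z(d₀) + Σ_{d₀ ∈ R(d)} i^{ε}𝓛(d/d₀)·(Σ_{e ∈ R(d₀)} i^{ε′}𝓛(d₀/e)·P(e))`, EXACT in `A(ℍ′_n)`.
[cite: TianYuanZhang2017, §3.1 (p0011 L67–L73), Prop. 3.4 (p0011 L76–L89)] -/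
theorem P_eq_two_step (D : GenusPointData n) (hrec : D.recursion) {d : ℕ} (hd : d ∈ n.divisors)
    (hd8 : d % 8 = 5 ∨ d % 8 = 6 ∨ d % 8 = 7) :
    D.P d = D.Z d
      - ∑ d₀ ∈ recursionIndex d, cmIPow D.im D.im_sq (D.eps d₀ (d / d₀)) (D.scriptL (d / d₀) • D.Z d₀)
      + ∑ d₀ ∈ recursionIndex d, cmIPow D.im D.im_sq (D.eps d₀ (d / d₀)) (D.scriptL (d / d₀) •
          ∑ e ∈ recursionIndex d₀, cmIPow D.im D.im_sq (D.eps e (d₀ / e)) (D.scriptL (d₀ / e) • D.P e)) := by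
  have hP := hrec d hd hd8
  have hinner : ∀ d₀ ∈ recursionIndex d,
      cmIPow D.im D.im_sq (D.eps d₀ (d / d₀)) (D.scriptL (d / d₀) • D.P d₀) =
        cmIPow D.im D.im_sq (D.eps d₀ (d / d₀)) (D.scriptL (d / d₀) • D.Z d₀) -
        cmIPow D.im D.im_sq (D.eps d₀ (d / d₀)) (D.scriptL (d / d₀) •
          ∑ e ∈ recursionIndex d₀, cmIPow D.im D.im_sq (D.eps e (d₀ / e)) (D.scriptL (d₀ / e) • D.P e)) := by
    intro d₀ hd₀
    obtain ⟨hd₀d, hd₀8, -, -⟩ := ThetaDescent.mem_recursionIndex_iff.mp hd₀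
    have hd₀n : d₀ ∈ n.divisors :=
      Nat.mem_divisors.mpr ⟨(Nat.mem_divisors.mp hd₀d).1.trans (Nat.mem_divisors.mp hd).1, (Nat.mem_divisors.mp hd).2⟩
    rw [hrec d₀ hd₀n hd₀8, smul_sub, map_sub]
  rw [hP, Finset.sum_congr rfl hinner, Finset.sum_sub_distrib]
  abel

/-! ## §2 The three-prime sector `n = l₁l₂m`, `l₁ ≡ l₂ ≡ 1`, `m ≡ 5` or `7 (mod 8)` -/

section TypeT

/-- **`recursionIndex (l₁l₂m) = {m, l₁m, l₂m}`** for distinct primes `l₁ ≡ l₂ ≡ 1 (mod 8)`, `m ≡ 5` or `7 (mod 8)` (cofactors `l₁l₂`, `l₂`, `l₁`, all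
`≡ 1 (mod 8)` and `> 1`; independent of the Legendre symbols). [cite: TianYuanZhang2017, §3.1 (p0011 L67–L70)] -/
theorem recursionIndex_typeT {l₁ l₂ m : ℕ} (hl₁ : l₁.Prime) (hl₂ : l₂.Prime) (hm : m.Prime) (h18 : l₁ % 8 = 1) (h28 : l₂ % 8 = 1)
    (hm8 : m % 8 = 5 ∨ m % 8 = 7) (hne : l₁ ≠ l₂) :
    recursionIndex (l₁ * l₂ * m) = {m, l₁ * m, l₂ * m} := by
  have hl₁1 := hl₁.one_lt; have hl₂1 := hl₂.one_lt; have hm1 := hm.one_lt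
  have hN0 : l₁ * l₂ * m ≠ 0 := Nat.mul_ne_zero (Nat.mul_ne_zero hl₁.ne_zero hl₂.ne_zero) hm.ne_zero
  have em : l₁ * l₂ * m / m = l₁ * l₂ := Nat.mul_div_cancel (l₁ * l₂) hm.pos
  have el₁m : l₁ * l₂ * m / (l₁ * m) = l₂ := by
    rw [show l₁ * l₂ * m = (l₁ * m) * l₂ by ring]; exact Nat.mul_div_cancel_left l₂ (Nat.mul_pos hl₁.pos hm.pos)
  have el₂m : l₁ * l₂ * m / (l₂ * m) = l₁ := by
    rw [show l₁ * l₂ * m = (l₂ * m) * l₁ by ring]; exact Nat.mul_div_cancel_left l₁ (Nat.mul_pos hl₂.pos hm.pos)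
  have el₁ : l₁ * l₂ * m / l₁ = l₂ * m := by
    rw [show l₁ * l₂ * m = l₁ * (l₂ * m) by ring]; exact Nat.mul_div_cancel_left _ hl₁.pos
  have el₂ : l₁ * l₂ * m / l₂ = l₁ * m := by
    rw [show l₁ * l₂ * m = l₂ * (l₁ * m) by ring]; exact Nat.mul_div_cancel_left _ hl₂.pos
  have el₁l₂ : l₁ * l₂ * m / (l₁ * l₂) = m := Nat.mul_div_cancel_left m (Nat.mul_pos hl₁.pos hl₂.pos)
  have eN : l₁ * l₂ * m / (l₁ * l₂ * m) = 1 := Nat.div_self (Nat.pos_of_ne_zero hN0)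
  have h12 : (l₁ * l₂) % 8 = 1 := by rw [Nat.mul_mod, h18, h28]
  have h1m : (l₁ * m) % 8 = m % 8 := mul_mod_eight_of_one h18
  have h2m : (l₂ * m) % 8 = m % 8 := mul_mod_eight_of_one h28
  ext d₀
  simp only [recursionIndex, Finset.mem_filter, Nat.mem_divisors, Finset.mem_insert, Finset.mem_singleton]
  constructor
  · rintro ⟨⟨hd, -⟩, h567, h123, hgt⟩
    rcases (dvd_mul_three_iff hl₁ hl₂ hm).mp hd with rfl | rfl | rfl | rfl | rfl | rfl | rfl | rfl
    · omega
    · omega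
    · omega
    · exact Or.inl rfl
    · omega
    · exact Or.inr (Or.inl rfl)
    · exact Or.inr (Or.inr rfl)
    · rw [eN] at hgt; omega
  · rintro (rfl | rfl | rfl)
    · refine ⟨⟨Dvd.intro_left (l₁ * l₂) rfl, hN0⟩, by omega, ?_, ?_⟩
      · rw [em]; omega
      · rw [em]; nlinarith
    · refine ⟨⟨Dvd.intro l₂ (by ring), hN0⟩, by omega, ?_, ?_⟩
      · rw [el₁m]; omega
      · rw [el₁m]; exact hl₂1
    · refine ⟨⟨Dvd.intro l₁ (by ring), hN0⟩, by omega, ?_, ?_⟩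
      · rw [el₂m]; omega
      · rw [el₂m]; exact hl₁1

/-- **Type T recursion, EXACT**: `P(m) = Z(m)`, `P(lᵢm) = Z(lᵢm) ∓ 𝓛(lᵢ)·Z(m)` (the odd two-prime shape) and
`P(l₁l₂m) = Z(l₁l₂m) − s₀·𝓛(l₁l₂)·Z(m) − s₁·𝓛(l₂)·P(l₁m) − s₂·𝓛(l₁)·P(l₂m)` with `s₀, s₁, s₂ = ±1` (all `ε`-types `(5 or 7, 1) ≠ (5,3)`).
[cite: TianYuanZhang2017, §3.1 (p0011 L67–L73), Thm. 3.3 (p0011 L49–L51)] -/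
theorem P_eq_of_typeT {l₁ l₂ m : ℕ} (hl₁ : l₁.Prime) (hl₂ : l₂.Prime) (hm : m.Prime) (h18 : l₁ % 8 = 1) (h28 : l₂ % 8 = 1)
    (hm8 : m % 8 = 5 ∨ m % 8 = 7) (hne : l₁ ≠ l₂) (hn : n = l₁ * l₂ * m)
    (D : GenusPointData n) (hrec : D.recursion) (heps : D.epsSpec) :
    D.P m = D.Z m ∧ ∃ s₀ s₁ s₂ : ℤ, (s₀ = 1 ∨ s₀ = -1) ∧ (s₁ = 1 ∨ s₁ = -1) ∧ (s₂ = 1 ∨ s₂ = -1) ∧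
      D.P n = D.Z n - s₀ • (D.scriptL (l₁ * l₂) • D.Z m) - s₁ • (D.scriptL l₂ • D.P (l₁ * m))
        - s₂ • (D.scriptL l₁ • D.P (l₂ * m)) := by
  subst hn
  have hN0 : l₁ * l₂ * m ≠ 0 := Nat.mul_ne_zero (Nat.mul_ne_zero hl₁.ne_zero hl₂.ne_zero) hm.ne_zero
  have em : l₁ * l₂ * m / m = l₁ * l₂ := Nat.mul_div_cancel (l₁ * l₂) hm.pos
  have el₁m : l₁ * l₂ * m / (l₁ * m) = l₂ := by
    rw [show l₁ * l₂ * m = (l₁ * m) * l₂ by ring]; exact Nat.mul_div_cancel_left l₂ (Nat.mul_pos hl₁.pos hm.pos)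
  have el₂m : l₁ * l₂ * m / (l₂ * m) = l₁ := by
    rw [show l₁ * l₂ * m = (l₂ * m) * l₁ by ring]; exact Nat.mul_div_cancel_left l₁ (Nat.mul_pos hl₂.pos hm.pos)
  have hm8' : m % 8 = 5 ∨ m % 8 = 6 ∨ m % 8 = 7 := by rcases hm8 with h | h <;> omega
  have hn8 : (l₁ * l₂ * m) % 8 = 5 ∨ (l₁ * l₂ * m) % 8 = 6 ∨ (l₁ * l₂ * m) % 8 = 7 := by
    have : (l₁ * l₂ * m) % 8 = m % 8 := by
      rw [mul_mod_eight_of_one (show (l₁ * l₂) % 8 = 1 by rw [Nat.mul_mod, h18, h28])]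
    rw [this]; exact hm8'
  have hPm : D.P m = D.Z m :=
    P_eq_Z_of_recursionIndex_eq_empty D hrec (Nat.mem_divisors.mpr ⟨Dvd.intro_left _ rfl, hN0⟩) hm8'
      (ThetaDescent.recursionIndex_prime hm)
  refine ⟨hPm, ?_⟩
  have hev : ∀ d₀ d₁ : ℕ, ¬ (d₀ % 8 = 5 ∧ d₁ % 8 = 3) → Even (D.eps d₀ d₁) := by
    intro d₀ d₁ hno
    rw [Nat.even_iff]
    by_contra hodd
    exact hno ((heps d₀ d₁).mp (by omega))
  have h12 : (l₁ * l₂) % 8 = 1 := by rw [Nat.mul_mod, h18, h28]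
  obtain ⟨s₀, hs₀, h₀⟩ := cmIPow_even_eq_sign_smul D (hev m (l₁ * l₂) (by omega))
  obtain ⟨s₁, hs₁, h₁⟩ := cmIPow_even_eq_sign_smul D (hev (l₁ * m) l₂ (by omega))
  obtain ⟨s₂, hs₂, h₂⟩ := cmIPow_even_eq_sign_smul D (hev (l₂ * m) l₁ (by omega))
  have hP := hrec (l₁ * l₂ * m) (Nat.mem_divisors_self _ hN0) hn8
  have hml₁m : m ≠ l₁ * m := by
    intro h; have : 1 * m = l₁ * m := by omega
    exact hl₁.one_lt.ne (Nat.eq_of_mul_eq_mul_right hm.pos this)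
  have hml₂m : m ≠ l₂ * m := by
    intro h; have : 1 * m = l₂ * m := by omega
    exact hl₂.one_lt.ne (Nat.eq_of_mul_eq_mul_right hm.pos this)
  have h12m : l₁ * m ≠ l₂ * m := fun h => hne (Nat.eq_of_mul_eq_mul_right hm.pos h)
  rw [recursionIndex_typeT hl₁ hl₂ hm h18 h28 hm8 hne, Finset.sum_insert (by simp [hml₁m, hml₂m]),
    Finset.sum_insert (by simpa using h12m), Finset.sum_singleton, em, el₁m, el₂m, h₀, h₁, h₂, hPm] at hP
  refine ⟨s₀, s₁, s₂, hs₀, hs₁, hs₂, ?_⟩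
  rw [hP]
  abel

/-- **Type T: `P(l₁l₂m) ≡ Z(l₁l₂m) − s₀𝓛(l₁l₂)·Z(m) − c₁·α₁ − c₂·α₂` modulo torsion**, `c₁ = s₁·c₂′·u₁·𝓛(l₁m)`, `c₂ = s₂·c₁′·u₂·𝓛(l₂m)`,
from `𝓛(l₁) = 2c₁′`, `𝓛(l₂) = 2c₂′` (Thm 1.1 at the primes `lᵢ ≡ 1 (mod 8)`) and Thm 3.5 at the two-prime sub-twists `l₁m`, `l₂m` read in `ℍ′_n`
(`h35₁`, `h35₂`: `2·P(lᵢm) − (uᵢ·𝓛(lᵢm))·αᵢ` torsion; `𝓛(lᵢm)` may be even — `lᵢm` of type R1/R2 — or zero).  The prime's genus point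
`Z(m) = P(m)` keeps the coefficient `𝓛(l₁l₂)`, which is NOT halved here.
[cite: TianYuanZhang2017, §3.1 (p0011 L67–L73), Thm. 3.5 (p0011 L94–L100), Thm. 1.1] -/
theorem genusPoint_typeT_congr {l₁ l₂ m : ℕ} (hl₁ : l₁.Prime) (hl₂ : l₂.Prime) (hm : m.Prime) (h18 : l₁ % 8 = 1) (h28 : l₂ % 8 = 1)
    (hm8 : m % 8 = 5 ∨ m % 8 = 7) (hne : l₁ ≠ l₂) (hn : n = l₁ * l₂ * m)
    (D : GenusPointData n) (hrec : D.recursion) (heps : D.epsSpec)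
    {c₁' c₂' : ℤ} (hL₁ : D.scriptL l₁ = 2 * c₁') (hL₂ : D.scriptL l₂ = 2 * c₂')
    {α₁ α₂ : APoint D.H} {u₁ u₂ : ℤ}
    (h35₁ : IsOfFinAddOrder ((2 : ℤ) • D.P (l₁ * m) - (u₁ * D.scriptL (l₁ * m)) • α₁))
    (h35₂ : IsOfFinAddOrder ((2 : ℤ) • D.P (l₂ * m) - (u₂ * D.scriptL (l₂ * m)) • α₂)) :
    ∃ s₀ s₁ s₂ : ℤ, (s₀ = 1 ∨ s₀ = -1) ∧ (s₁ = 1 ∨ s₁ = -1) ∧ (s₂ = 1 ∨ s₂ = -1) ∧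
      IsOfFinAddOrder (D.P n - (D.Z n - s₀ • (D.scriptL (l₁ * l₂) • D.Z m)
        - (s₁ * c₂' * (u₁ * D.scriptL (l₁ * m))) • α₁ - (s₂ * c₁' * (u₂ * D.scriptL (l₂ * m))) • α₂)) := by
  obtain ⟨-, s₀, s₁, s₂, hs₀, hs₁, hs₂, hP⟩ := P_eq_of_typeT hl₁ hl₂ hm h18 h28 hm8 hne hn D hrec heps
  refine ⟨s₀, s₁, s₂, hs₀, hs₁, hs₂, ?_⟩
  have e : D.P n - (D.Z n - s₀ • (D.scriptL (l₁ * l₂) • D.Z m)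
        - (s₁ * c₂' * (u₁ * D.scriptL (l₁ * m))) • α₁ - (s₂ * c₁' * (u₂ * D.scriptL (l₂ * m))) • α₂) =
      (-(s₁ * c₂')) • ((2 : ℤ) • D.P (l₁ * m) - (u₁ * D.scriptL (l₁ * m)) • α₁) +
        (-(s₂ * c₁')) • ((2 : ℤ) • D.P (l₂ * m) - (u₂ * D.scriptL (l₂ * m)) • α₂) := by
    rw [hP, hL₁, hL₂]
    module
  rw [e]
  exact (h35₁.zsmul).add h35₂.zsmul

/-- **Type T, `𝓛(l₁l₂) = 2b` even: `Z(m)` folds into the generator class of `E_m`** — with Thm 3.5 at `m` (`h35m`, `𝓛(m)` odd in print):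
`P(l₁l₂m) ≡ Z(l₁l₂m) − (s₀·b·u·𝓛(m))·α_m − c₁·α₁ − c₂·α₂` modulo torsion.  (When `𝓛(l₁l₂)` is odd — `g(l₁l₂)` odd, Thm 1.1 at the rank-zero twist
`l₁l₂ ≡ 1 (mod 8)` — the term `s₀𝓛(l₁l₂)·Z(m)` cannot be halved and the prime's genus point survives verbatim.)
[cite: TianYuanZhang2017, §3.1 (p0011 L67–L73), Thm. 3.5 (p0011 L94–L100), Thm. 1.1] -/
theorem genusPoint_typeT_congr_of_even {l₁ l₂ m : ℕ} (hl₁ : l₁.Prime) (hl₂ : l₂.Prime) (hm : m.Prime) (h18 : l₁ % 8 = 1)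
    (h28 : l₂ % 8 = 1) (hm8 : m % 8 = 5 ∨ m % 8 = 7) (hne : l₁ ≠ l₂) (hn : n = l₁ * l₂ * m)
    (D : GenusPointData n) (hrec : D.recursion) (heps : D.epsSpec)
    {c₁' c₂' b : ℤ} (hL₁ : D.scriptL l₁ = 2 * c₁') (hL₂ : D.scriptL l₂ = 2 * c₂') (hL₁₂ : D.scriptL (l₁ * l₂) = 2 * b)
    {α₁ α₂ αm : APoint D.H} {u₁ u₂ u : ℤ}
    (h35₁ : IsOfFinAddOrder ((2 : ℤ) • D.P (l₁ * m) - (u₁ * D.scriptL (l₁ * m)) • α₁))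
    (h35₂ : IsOfFinAddOrder ((2 : ℤ) • D.P (l₂ * m) - (u₂ * D.scriptL (l₂ * m)) • α₂))
    (h35m : IsOfFinAddOrder ((2 : ℤ) • D.P m - (u * D.scriptL m) • αm)) :
    ∃ s₀ s₁ s₂ : ℤ, (s₀ = 1 ∨ s₀ = -1) ∧ (s₁ = 1 ∨ s₁ = -1) ∧ (s₂ = 1 ∨ s₂ = -1) ∧
      IsOfFinAddOrder (D.P n - (D.Z n - (s₀ * b * (u * D.scriptL m)) • αm
        - (s₁ * c₂' * (u₁ * D.scriptL (l₁ * m))) • α₁ - (s₂ * c₁' * (u₂ * D.scriptL (l₂ * m))) • α₂)) := by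
  obtain ⟨hPm, -⟩ := P_eq_of_typeT hl₁ hl₂ hm h18 h28 hm8 hne hn D hrec heps
  obtain ⟨s₀, s₁, s₂, hs₀, hs₁, hs₂, h⟩ := genusPoint_typeT_congr hl₁ hl₂ hm h18 h28 hm8 hne hn D hrec heps hL₁ hL₂ h35₁ h35₂
  refine ⟨s₀, s₁, s₂, hs₀, hs₁, hs₂, ?_⟩
  have e : D.P n - (D.Z n - (s₀ * b * (u * D.scriptL m)) • αm
        - (s₁ * c₂' * (u₁ * D.scriptL (l₁ * m))) • α₁ - (s₂ * c₁' * (u₂ * D.scriptL (l₂ * m))) • α₂) =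
      (D.P n - (D.Z n - s₀ • (D.scriptL (l₁ * l₂) • D.Z m)
        - (s₁ * c₂' * (u₁ * D.scriptL (l₁ * m))) • α₁ - (s₂ * c₁' * (u₂ * D.scriptL (l₂ * m))) • α₂))
      + (-(s₀ * b)) • ((2 : ℤ) • D.P m - (u * D.scriptL m) • αm) := by
    rw [hL₁₂, hPm]
    module
  rw [e]
  exact h.add h35m.zsmul

/-- **Type T, `𝓛(l₁l₂)` even: C⁺ at `l₁l₂m` = ONE depth comparison** — `2 ∥ 𝓛(l₁l₂m)` iff for every `k`,
`Z(l₁l₂m) − c_m·α_m − c₁·α₁ − c₂·α₂ ∈ 2^k A(ℍ′_n) + tors ⟺ Q₁ ∈ 2^k A(ℍ′_n) + tors` (g3's criterion; data as in `levelTwo_two_primes_iff` plus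
`h35₁`, `h35₂`, `h35m`). [cite: TianYuanZhang2017, Thm. 3.5 (p0011 L94–L100), §3.1 (p0011 L67–L73)] [cite: Darmon2004, Thm. 3.22] -/
theorem levelTwo_typeT_iff_of_even {l₁ l₂ m : ℕ} (hl₁ : l₁.Prime) (hl₂ : l₂.Prime) (hm : m.Prime) (h18 : l₁ % 8 = 1)
    (h28 : l₂ % 8 = 1) (hm8 : m % 8 = 5 ∨ m % 8 = 7) (hne : l₁ ≠ l₂) (hn : n = l₁ * l₂ * m)
    (hGZK : rank_eq_analyticRank_of_analyticRank_le_one) (hsq : Squarefree n) (hr : (congruentNumberCurve n).analyticRank = 1)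
    (D : GenusPointData n) (h35 : D.thm35Main) (hLs : D.scriptLSpec) (hrec : D.recursion) (heps : D.epsSpec)
    {c₁' c₂' b : ℤ} (hL₁ : D.scriptL l₁ = 2 * c₁') (hL₂ : D.scriptL l₂ = 2 * c₂') (hL₁₂ : D.scriptL (l₁ * l₂) = 2 * b)
    {α₁ α₂ αm : APoint D.H} {u₁ u₂ u : ℤ}
    (h35₁ : IsOfFinAddOrder ((2 : ℤ) • D.P (l₁ * m) - (u₁ * D.scriptL (l₁ * m)) • α₁))
    (h35₂ : IsOfFinAddOrder ((2 : ℤ) • D.P (l₂ * m) - (u₂ * D.scriptL (l₂ * m)) • α₂))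
    (h35m : IsOfFinAddOrder ((2 : ℤ) • D.P m - (u * D.scriptL m) • αm))
    {R : (congruentNumberCurve n).toAffine.Point} (hR : ∀ x, ∃ k : ℤ, IsOfFinAddOrder (x - k • R))
    {Q₁ : APoint D.H} (hQ₁ : φH D Q₁ = Point.map (W' := curveA.twoIsogenyCodomain)
      (D.embK n (Nat.mem_divisors_self n hsq.ne_zero)) (ΘE hsq.ne_zero R)) :
    ∃ s₀ s₁ s₂ : ℤ, (s₀ = 1 ∨ s₀ = -1) ∧ (s₁ = 1 ∨ s₁ = -1) ∧ (s₂ = 1 ∨ s₂ = -1) ∧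
      ((∀ L : ℤ, IsScriptL n L → (2 : ℤ) ∣ L ∧ ¬ (4 : ℤ) ∣ L) ↔
        ∀ k : ℕ, ((∃ y : APoint D.H, IsOfFinAddOrder (D.Z n - (s₀ * b * (u * D.scriptL m)) • αm
            - (s₁ * c₂' * (u₁ * D.scriptL (l₁ * m))) • α₁ - (s₂ * c₁' * (u₂ * D.scriptL (l₂ * m))) • α₂ - ((2 : ℤ) ^ k) • y)) ↔
          ∃ y : APoint D.H, IsOfFinAddOrder (Q₁ - ((2 : ℤ) ^ k) • y))) := by
  have h8 : n % 8 = 5 ∨ n % 8 = 6 ∨ n % 8 = 7 := by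
    have : n % 8 = m % 8 := by
      rw [hn, mul_mod_eight_of_one (show (l₁ * l₂) % 8 = 1 by rw [Nat.mul_mod, h18, h28])]
    rw [this]; rcases hm8 with h | h
    · exact Or.inl h
    · exact Or.inr (Or.inr h)
  obtain ⟨s₀, s₁, s₂, hs₀, hs₁, hs₂, h⟩ :=
    genusPoint_typeT_congr_of_even hl₁ hl₂ hm h18 h28 hm8 hne hn D hrec heps hL₁ hL₂ hL₁₂ h35₁ h35₂ h35m
  refine ⟨s₀, s₁, s₂, hs₀, hs₁, hs₂, ?_⟩
  rw [levelTwo_iff_twoPowDivisible_iff_half hGZK hsq h8 hr D h35 hLs hR hQ₁]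
  exact forall_congr' fun k => by rw [twoPowDivisible_iff_of_sub_isOfFinAddOrder h k]

end TypeT

end Summit.BirchSwinnertonDyer.PrintCf2.LevelTwoTwoStep

end
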